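import Literature.AlgebraicGeometry.Resolution.DeepDiscFiniteLevel
import Literature.AlgebraicGeometry.Resolution.RelativeCurveAmbientHypotheses
import HarnessLib

/-!
# Deep split discs at a finite purely inseparable level — in the vocabulary of the algebraization (J2)

Topic: `Literature/AlgebraicGeometry/Resolution` (valued function fields). M. Temkin, *Inseparable
local uniformization*, J. Algebra 373 (2013) = arXiv:0804.1554v3, Thm. 3.3.1 (proof, Step 2) and
Thm. 3.2.6 (proof, Step 2). `DeepDiscFiniteLevel.lean` proves, for subfields `k ≤ K₁` of an
algebraically closed valued field `(Ω, V)`, the existence of arbitrarily deep rational discs around a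
transcendental element after a finite purely inseparable extension of `k` (characteristic `p`:
`exists_level_deep_disc`; residue characteristic `0`: `exists_deep_disc_of_charZero`, no
extension). This file restates that result behind the binders of the algebraization hypothesis
hJ2 of `Temkin2013RelativeCurveSmoothFibre.of_algebraization` / `Temkin2013.of_algebraization`
(`RelativeCurveSmoothFibreFromJ2.lean`): TYPES `k → K → K₁ → Ω` with their algebra maps, the
valuation rings induced by `V`, equal characteristic, height one of `k°`, `|K^×|/|k^×|` torsion and
`K̃/k̃` algebraic, `K₁/K` finite, `x : K₁` transcendental over `k` — in ALL equal characteristics at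
once (the characteristic split of `valuativeInput_J1`):

* `exists_level_deep_disc_of_smoothFibre_data` — for such data and a finite set `Θ ⊆ Ω` of
  elements algebraic over `k`: a finite `S ⊆ Ω` of purely inseparable elements over (the image of)
  `k` and `a, d ∈ Ω` algebraic over `k`, separable over `k(S)`, lying in the henselization of
  `K₁ ⊔ k(S)` inside `(Ω, V)`, with `d ≠ 0`, `|x − a| = |d| ≤ |x|` and `|d| < |x − θ|` for all
  `θ ∈ Θ`; `S ⊆ perfectClosure k Ω` is also recorded, in the form consumed by
  `exists_smoothFibre_level` — PROVED.

Intended use (see the module docstring of `DeepDiscFiniteLevel.lean`): a proof of hJ2 chooses the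
finite set `Θ` of algebraic points its charts must avoid, takes `(S, a, d)` from this theorem,
passes to the purely inseparable level `S` (`exists_smoothFibre_level`,
`RelativeCurveLevelReduction.lean`), builds the chart datum there with the disc `|X − a| ≤ |d|` and
constants `l₀(Y, a, d, …)`, concludes with `RelCurveChart.conclusion`, and descends.

The statement is [folklore] glue over the cited results; no definitions, no named facts.

## Sources

* M. Temkin, arXiv:0804.1554v3, Thm. 3.2.6 (proof, Step 2), Thm. 3.3.1 (proof, Step 2),
  Cor. 3.1.10. [Temkin2013]
-/

noncomputable section

open IsLocalRing

namespace Literature.AlgebraicGeometry.Resolution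

universe u

set_option maxHeartbeats 800000 in
/-- **Deep split discs at a finite purely inseparable level, for the data of the algebraization
(J2) of Thm. 3.3.1, in all equal characteristics.** Let `k → K → K₁ → Ω` be fields with compatible
algebra maps, `Ω` algebraically closed with valuation ring `V` inducing `K₁° = O₁ ⊇ K° = O ⊇ k° = Ok`
(`hV, hO₁, hOk`, as in hJ2), `k°` of the residue characteristic of `k` (equal characteristic) and
of height one, `K₁/K` finite, `|K^×|/|k^×|` torsion and `K̃/k̃` algebraic (for `O`). Let
`x : K₁` have transcendental image over `k` and let `Θ ⊆ Ω` be finite with every element algebraic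
over `k`. Then there are a finite `S ⊆ Ω`, each `s ∈ S` with `s^{q^n}` in the image of `k` for some
`n` (`q` the exponential characteristic), and `a, d ∈ Ω` algebraic over `k`, separable over the
subfield `k(S)`, lying in `henselization V (K₁ ⊔ k(S))`, with `d ≠ 0`, `|x − a| = |d| ≤ |x|` and
`|d| < |x − θ|` for every `θ ∈ Θ`. PROVED (`exists_level_deep_disc` in characteristic `p`,
`exists_deep_disc_of_charZero` with `S = ∅` in residue characteristic `0`).
[cite: Temkin2013, Thm. 3.2.6 (proof, Step 2) and Cor. 3.1.10] -/
theorem exists_level_deep_disc_of_smoothFibre_data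
    (k K K₁ Ω : Type u) [Field k] [Field K] [Field K₁] [Field Ω] [IsAlgClosed Ω]
    [Algebra k K] [Algebra K K₁] [Algebra k K₁] [IsScalarTower k K K₁]
    [Algebra K₁ Ω] [Algebra K Ω] [Algebra k Ω] [IsScalarTower K K₁ Ω] [IsScalarTower k K₁ Ω]
    [FiniteDimensional K K₁]
    (Ok : ValuationSubring k) (O : ValuationSubring K) (O₁ : ValuationSubring K₁)
    (hOk : O.comap (algebraMap k K) = Ok) (hO₁ : O₁.comap (algebraMap K K₁) = O)
    (hchar : ringChar (ResidueField Ok) = ringChar k) (hk1 : ringKrullDim Ok = 1)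
    (hvt : IsValueTorsionOver O (algebraMap k K).fieldRange ⊤)
    (hra : IsResiduallyAlgebraicOver O (algebraMap k K).fieldRange ⊤)
    (V : ValuationSubring Ω) (hV : V.comap (algebraMap K₁ Ω) = O₁)
    (x : K₁) (hxtr : Transcendental k (algebraMap K₁ Ω x))
    (Θ : Finset Ω) (hΘ : ∀ θ ∈ Θ, IsAlgebraic k θ) :
    ∃ (S : Finset Ω) (a d : Ω),
      (∀ s ∈ S, ∃ n : ℕ, s ^ (ringExpChar Ω) ^ n ∈ (algebraMap k Ω).fieldRange) ∧
      (↑S : Set Ω) ⊆ (perfectClosure k Ω : Set Ω) ∧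
      IsAlgebraic k a ∧ IsAlgebraic k d ∧
      IsSeparable (Subfield.closure (((algebraMap k Ω).fieldRange : Set Ω) ∪ ↑S)) a ∧
      IsSeparable (Subfield.closure (((algebraMap k Ω).fieldRange : Set Ω) ∪ ↑S)) d ∧
      a ∈ henselization V ((algebraMap K₁ Ω).fieldRange ⊔
        Subfield.closure (((algebraMap k Ω).fieldRange : Set Ω) ∪ ↑S)) ∧
      d ∈ henselization V ((algebraMap K₁ Ω).fieldRange ⊔
        Subfield.closure (((algebraMap k Ω).fieldRange : Set Ω) ∪ ↑S)) ∧
      d ≠ 0 ∧ V.valuation (algebraMap K₁ Ω x - a) = V.valuation d ∧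
      V.valuation d ≤ V.valuation (algebraMap K₁ Ω x) ∧
      ∀ θ ∈ Θ, V.valuation d < V.valuation (algebraMap K₁ Ω x - θ) := by
  classical
  have hH := Kuhlmann2010HenselizationIsHenselian_holds.{u}
  -- the valuation rings induced by `V`
  have hO : (V.comap (algebraMap K₁ Ω)).comap (algebraMap K K₁) = O := by rw [hV, hO₁]
  have hVk : V.comap (algebraMap k Ω) = Ok := by
    rw [← hOk, ← hO, ValuationSubring.comap_comap, ValuationSubring.comap_comap,
      ← IsScalarTower.algebraMap_eq k K K₁, ← IsScalarTower.algebraMap_eq k K₁ Ω]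
  rw [← hO] at hvt hra
  set kΩ : Subfield Ω := (algebraMap k Ω).fieldRange with hkΩdef
  set K₁Ω : Subfield Ω := (algebraMap K₁ Ω).fieldRange with hK₁Ωdef
  -- `k ≅ kΩ` (for transporting algebraicity statements)
  let f : k →+* kΩ := (algebraMap k Ω).rangeRestrictField
  have hfbij : Function.Bijective f := (algebraMap k Ω).rangeRestrictField_bijective
  have hcomp : (algebraMap kΩ Ω).comp f = (RingHom.id Ω).comp (algebraMap k Ω) := by ext; rfl
  have halg_to : ∀ {z : Ω}, IsAlgebraic k z → IsAlgebraic kΩ z := fun hz =>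
    hz.ringHom_of_comp_eq f (RingHom.id Ω) hfbij.1 hcomp
  have halg_of : ∀ {z : Ω}, IsAlgebraic kΩ z → IsAlgebraic k z := fun hz =>
    hz.of_ringHom_of_comp_eq f (RingHom.id Ω) hfbij.2 (RingHom.id Ω).injective hcomp
  -- the hypotheses in subfield form
  have hle : kΩ ≤ K₁Ω := by
    rintro _ ⟨c, rfl⟩
    exact ⟨algebraMap k K₁ c, (IsScalarTower.algebraMap_apply k K₁ Ω c).symm⟩
  have hvtΩ : IsValueTorsionOver V kΩ K₁Ω := isValueTorsionOver_fieldRange_of_finiteDimensional V hvt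
  have hraΩ : IsResiduallyAlgebraicOver V kΩ K₁Ω :=
    isResiduallyAlgebraicOver_fieldRange_of_finiteDimensional V hra
  have hr1 : IsRankOneValued V kΩ := by
    refine isRankOneValued_fieldRange_of_ringKrullDim_eq_one V ?_
    rw [hVk]
    exact hk1
  have hxK₁Ω : algebraMap K₁ Ω x ∈ K₁Ω := ⟨x, rfl⟩
  have hxtrΩ : Transcendental kΩ (algebraMap K₁ Ω x) :=
    hxtr.ringHom_of_comp_eq f (RingHom.id Ω) hfbij.2 (RingHom.id Ω).injective hcomp
  have hΘΩ : ∀ θ ∈ Θ, IsAlgebraic kΩ θ := fun θ hθ => halg_to (hΘ θ hθ)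
  -- equal characteristic for `V`
  have hexp : ringExpChar (ResidueField V) = ringExpChar Ω := by
    refine ringExpChar_residueField_eq_of_equichar (k := k) V ?_
    rw [hVk]
    exact hchar
  obtain ⟨q, hq⟩ := ExpChar.exists Ω
  rcases hq with _ | ⟨hprime⟩
  · ------------------------------------------------------------------
    -- residue characteristic `0`: no level (`S = ∅`)
    ------------------------------------------------------------------
    haveI : ExpChar Ω 1 := ExpChar.zero
    have hq1 : ringExpChar Ω = 1 := ringExpChar.eq Ω 1
    haveI : ExpChar (ResidueField V) 1 := ringExpChar.of_eq (hexp.trans hq1)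
    haveI : CharZero (ResidueField V) := charZero_of_expChar_one' (ResidueField V)
    obtain ⟨a, d, haalg, hdalg, hah, hdh, hd0, hxad, hdx, hdeep⟩ :=
      exists_deep_disc_of_charZero V kΩ K₁Ω hle hvtΩ hraΩ hxK₁Ω hxtrΩ Θ hΘΩ
    -- separability over `k(∅) = kΩ` (characteristic `0`)
    set L : Subfield Ω := Subfield.closure ((kΩ : Set Ω) ∪ ↑(∅ : Finset Ω)) with hLdef
    have hkL : kΩ ≤ L := fun z hz => Subfield.subset_closure (Or.inl hz)
    haveI : CharZero L := L.subtype.charZero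
    haveI : PerfectField L := PerfectField.ofCharZero
    have hsepL : ∀ {z : Ω}, IsAlgebraic kΩ z → IsSeparable L z := fun hz =>
      PerfectField.separable_of_irreducible
        (minpoly.irreducible (isAlgebraic_of_subfield_le hkL hz).isIntegral)
    have hmono : henselization V K₁Ω ≤ henselization V (K₁Ω ⊔ L) :=
      henselization_mono V hH le_sup_left
    exact ⟨∅, a, d, fun _ h => (Finset.notMem_empty _ h).elim, by simp, halg_of haalg, halg_of hdalg,
      hsepL haalg, hsepL hdalg, hmono hah, hmono hdh, hd0, hxad, hdx, hdeep⟩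
  · ------------------------------------------------------------------
    -- characteristic `p = q > 0`
    ------------------------------------------------------------------
    haveI : Fact q.Prime := ⟨hprime⟩
    haveI : ExpChar Ω q := ExpChar.prime hprime
    have hqq : ringExpChar Ω = q := ringExpChar.eq Ω q
    have hres : ExpChar (ResidueField V) q := ringExpChar.of_eq (hexp.trans hqq)
    haveI : CharP (ResidueField V) q := by
      rcases hres with _ | ⟨hp'⟩
      · exact absurd hprime Nat.not_prime_one
      · infer_instance
    obtain ⟨S, a, d, hS, haalg, hdalg, hasep, hdsep, hah, hdh, hd0, hxad, hdx, hdeep⟩ :=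
      exists_level_deep_disc V q kΩ K₁Ω hle hr1 hvtΩ hraΩ hxK₁Ω hxtrΩ Θ hΘΩ
    -- `S ⊆` the relative perfect closure of `k` in `Ω`
    haveI : CharP k q := (RingHom.charP_iff_charP (algebraMap k Ω) q).mpr inferInstance
    haveI : ExpChar k q := ExpChar.prime hprime
    have hSperf : (↑S : Set Ω) ⊆ (perfectClosure k Ω : Set Ω) := by
      intro s hs
      obtain ⟨n, hn⟩ := hS s (Finset.mem_coe.mp hs)
      rw [hqq] at hn
      obtain ⟨c, hc⟩ := RingHom.mem_fieldRange.mp hn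
      rw [SetLike.mem_coe, mem_perfectClosure_iff_pow_mem q]
      exact ⟨n, RingHom.mem_range.mpr ⟨c, hc⟩⟩
    exact ⟨S, a, d, hS, hSperf, halg_of haalg, halg_of hdalg, hasep, hdsep, hah, hdh, hd0, hxad, hdx,
      hdeep⟩

end Literature.AlgebraicGeometry.Resolution

end
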